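import Summits.PneNP.PneNP.Theses.NoTardosTropics
import Literature.Computability.Complexity.FournierKoiranPointLocation
import HarnessLib

/-!
# Route `NoTardosTropics`, item `FKThm3Digital` (stmt-PneNP-2564): Fournier–Koiran's transfer, proved

The route decl `Summit.PneNP.PneNP.Theses.NoTardosTropics.FKThm3Digital` is, after unfolding the
sign-oracle classes of `Literature/Computability/Complexity/AdditiveRealClasses.lean`
(`NDPAdd`, `PAddRel`, `PAddRelClass`, `signOracle`, `signOracleWith`), the inclusion
`NDPAdd ⊆ PAddRelClass NP` — Fournier–Koiran, *Lower bounds are not easier over the reals: inside PH*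
(ICALP 2000 = LIP RR-1999-21), Theorem 3 with Fact 2 (`NP⁰_ℝovs = NDP⁰_ℝovs`), digital form. That
inclusion is the Literature theorem
`Literature.Computability.Complexity.FKPointLocation.fournierKoiran2000_NDPAdd_subset_PAddRelClass_NP_holds`
(`FournierKoiranPointLocation.lean`: Theorem 2 — point location by a polynomial `NP`/sign protocol,
Meyer auf der Heide's construction made uniform — assembled with the final `NP` check of Theorem 3),
so the item closes by unfolding.
-/

set_option linter.dupNamespace false -- `Summit.PneNP.PneNP.…`: summit = sub-problem (D-0017)

namespace Summit.PneNP.PneNP.Theorems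

open Literature.Computability.Complexity

/-- **`FKThm3Digital` holds**: every real language with a polynomial-time sign-query verifier of
polynomially long Boolean witnesses is decided by a polynomial-time sign-query algorithm with some
Boolean `NP` oracle (Fournier–Koiran 2000, Thm 3 with Fact 2, in the route's sign-oracle rendering).
[cite: FournierKoiran2000, Thm 3 (report p. 10) with Fact 2 and Thm 2] -/
theorem FKThm3Digital_proof : Summit.PneNP.PneNP.Theses.NoTardosTropics.FKThm3Digital := by
  unfold Summit.PneNP.PneNP.Theses.NoTardosTropics.FKThm3Digital
  intro L hL
  exact FKPointLocation.fournierKoiran2000_NDPAdd_subset_PAddRelClass_NP_holds (show L ∈ NDPAdd from hL)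

end Summit.PneNP.PneNP.Theorems
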